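import Summits.QuantumAdvantage.QuantumAdvantage.Theorems.CharDialJBlockFrob
import HarnessLib

/-!
# ExchangeBridge — from transposition invariance to block-weight dependence (kernel glue for L2G)

(decomp-qadv-lens-6 g8.)  `SubChar.symm_of_swap_invariant`: if `f` is invariant under every transposition of two
coordinates of `A`, then `f u = f v` whenever `u, v` agree off `A` and have the same weight on `A` (Hamming-distance
induction).  With `SubChar.agree_of_irrelevant` (coordinates `f` ignores may be changed freely) this gives
`SubChar.blockSymm_of_swap` — the symmetry hypothesis of `jBlock_frob` / `jBlock_frob_law` in the exchangeability
language — and hence `SubChar.law_of_exchangeable_blocks`: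
  (bounded junta `J`) + (pairwise disjoint blocks `A_j ⊇`-exchangeable variables, each `≥ p − 1`, disjoint from `J`)
  + (all other variables irrelevant) + (`deg_p f ≤ p − 1`)  ⟹  `f u = h(u_J, Σ cᵢuᵢ)`,
i.e. L2G (PLAN-g9.md §9) ⟹ the node's `FrobStructureLaw`, as one kernel implication.
-/

namespace Summit.QuantumAdvantage.AdviceFreeQNC0

namespace SubChar

open Finset
open Literature.Computability.MetaComplexity

variable {n : ℕ}

/-- CharDial sub-characteristic helper `swap_mem_of_mem` (lens-6 g8 LAND package; see the module docstring). -/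
theorem swap_mem_of_mem {A : Finset (Fin n)} {i j : Fin n} (hi : i ∈ A) (hj : j ∈ A) {k : Fin n} (hk : k ∈ A) :
    Equiv.swap i j k ∈ A := by
  by_cases hki : k = i
  · rw [hki, Equiv.swap_apply_left]; exact hj
  · by_cases hkj : k = j
    · rw [hkj, Equiv.swap_apply_right]; exact hi
    · rw [Equiv.swap_apply_of_ne_of_ne hki hkj]; exact hk

/-- A transposition inside `A` does not change the weight on `A`. -/
theorem bw_comp_swap {A : Finset (Fin n)} {i j : Fin n} (hi : i ∈ A) (hj : j ∈ A) (u : Fin n → Bool) :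
    bw A (u ∘ Equiv.swap i j) = bw A u := by
  classical
  unfold bw
  refine Finset.card_bij' (fun k _ => Equiv.swap i j k) (fun k _ => Equiv.swap i j k) ?_ ?_ ?_ ?_
  · intro k hk
    rw [mem_filter] at hk ⊢
    exact ⟨swap_mem_of_mem hi hj hk.1, hk.2⟩
  · intro k hk
    rw [mem_filter] at hk ⊢
    refine ⟨swap_mem_of_mem hi hj hk.1, ?_⟩
    show u (Equiv.swap i j (Equiv.swap i j k)) = true
    rw [Equiv.swap_apply_self]; exact hk.2
  · intro k _; exact Equiv.swap_apply_self _ _ _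
  · intro k _; exact Equiv.swap_apply_self _ _ _

/-- **Transposition invariance inside `A` ⇒ `f` sees `A` only through the weight.** -/
theorem symm_of_swap_invariant {A : Finset (Fin n)} (f : (Fin n → Bool) → Bool)
    (hswap : ∀ u : Fin n → Bool, ∀ i ∈ A, ∀ j ∈ A, f (u ∘ Equiv.swap i j) = f u) :
    ∀ u v : Fin n → Bool, (∀ k, k ∉ A → u k = v k) → bw A u = bw A v → f u = f v := by
  classical
  suffices H : ∀ d : ℕ, ∀ u v : Fin n → Bool, (A.filter fun k => u k ≠ v k).card ≤ d →
      (∀ k, k ∉ A → u k = v k) → bw A u = bw A v → f u = f v from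
    fun u v h1 h2 => H _ u v le_rfl h1 h2
  -- if `x` has `a x = true`, `b x = false` and the `A`-weights agree, some `y ∈ A` has `a y = false`, `b y = true`
  have ext : ∀ a b : Fin n → Bool,
      (A.filter fun k => a k = true).card = (A.filter fun k => b k = true).card →
      ∀ x, x ∈ A → a x = true → b x = false → ∃ y, y ∈ A ∧ a y = false ∧ b y = true := by
    intro a b hab x hxA hax hbx
    by_contra hcon
    have hsub : (A.filter fun k => b k = true) ⊆ (A.filter fun k => a k = true) := by
      intro y hy
      rw [mem_filter] at hy ⊢
      refine ⟨hy.1, ?_⟩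
      by_contra hay
      exact hcon ⟨y, hy.1, by simpa using hay, hy.2⟩
    have hEq := Finset.eq_of_subset_of_card_le hsub hab.le
    have hx : x ∈ A.filter fun k => a k = true := mem_filter.2 ⟨hxA, hax⟩
    rw [← hEq] at hx
    have hbx' := (mem_filter.1 hx).2
    rw [hbx] at hbx'
    exact Bool.false_ne_true hbx'
  intro d
  induction d with
  | zero =>
    intro u v hd huv _
    have huv' : u = v := by
      funext k
      by_cases hk : k ∈ A
      · by_contra hne
        have hmem : k ∈ A.filter fun k => u k ≠ v k := mem_filter.2 ⟨hk, hne⟩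
        rw [Nat.le_zero, card_eq_zero] at hd
        rw [hd] at hmem
        exact Finset.notMem_empty k hmem
      · exact huv k hk
    rw [huv']
  | succ d ih =>
    intro u v hd huv hbw
    by_cases hD : (A.filter fun k => u k ≠ v k).card ≤ d
    · exact ih u v hD huv hbw
    · obtain ⟨k, hk⟩ : (A.filter fun k => u k ≠ v k).Nonempty := by
        rw [← Finset.card_pos]; omega
      have hkA : k ∈ A := (mem_filter.1 hk).1
      have hkne : u k ≠ v k := (mem_filter.1 hk).2
      have hUV : (A.filter fun k => u k = true).card = (A.filter fun k => v k = true).card := hbw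
      -- one coordinate of each kind
      have key : ∃ i j, i ∈ A ∧ j ∈ A ∧ u i = true ∧ v i = false ∧ u j = false ∧ v j = true := by
        cases hu : u k with
        | true =>
          have hv : v k = false := by
            cases hvk : v k
            · rfl
            · exact absurd (hu.trans hvk.symm) hkne
          obtain ⟨j, hjA, huj, hvj⟩ := ext u v hUV k hkA hu hv
          exact ⟨k, j, hkA, hjA, hu, hv, huj, hvj⟩
        | false =>
          have hv : v k = true := by
            cases hvk : v k
            · exact absurd (hu.trans hvk.symm) hkne
            · rfl
          obtain ⟨i, hiA, hvi, hui⟩ := ext v u hUV.symm k hkA hv hu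
          exact ⟨i, k, hiA, hkA, hui, hvi, hu, hv⟩
      obtain ⟨i, j, hiA, hjA, hui, hvi, huj, hvj⟩ := key
      have hu'i : (u ∘ Equiv.swap i j) i = false := by
        show u (Equiv.swap i j i) = false
        rw [Equiv.swap_apply_left]; exact huj
      have hu'j : (u ∘ Equiv.swap i j) j = true := by
        show u (Equiv.swap i j j) = true
        rw [Equiv.swap_apply_right]; exact hui
      have hu'k : ∀ k, k ≠ i → k ≠ j → (u ∘ Equiv.swap i j) k = u k := fun k hki hkj => by
        show u (Equiv.swap i j k) = u k
        rw [Equiv.swap_apply_of_ne_of_ne hki hkj]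
      rw [← hswap u i hiA j hjA]
      refine ih (u ∘ Equiv.swap i j) v ?_ ?_ ?_
      · have hsub : (A.filter fun k => (u ∘ Equiv.swap i j) k ≠ v k) ⊆ (A.filter fun k => u k ≠ v k).erase i := by
          intro k hk
          rw [mem_filter] at hk
          rw [mem_erase, mem_filter]
          have hki : k ≠ i := by rintro rfl; exact hk.2 (by rw [hu'i, hvi])
          have hkj : k ≠ j := by rintro rfl; exact hk.2 (by rw [hu'j, hvj])
          exact ⟨hki, hk.1, by rw [← hu'k k hki hkj]; exact hk.2⟩
        have hiold : i ∈ A.filter fun k => u k ≠ v k := mem_filter.2 ⟨hiA, by rw [hui, hvi]; decide⟩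
        have h1 := card_le_card hsub
        rw [card_erase_of_mem hiold] at h1
        omega
      · intro k hk
        have hki : k ≠ i := fun h => hk (by rw [h]; exact hiA)
        have hkj : k ≠ j := fun h => hk (by rw [h]; exact hjA)
        rw [hu'k k hki hkj]; exact huv k hk
      · rw [bw_comp_swap hiA hjA]; exact hbw

/-- Coordinates that `f` ignores may be changed freely. -/
theorem agree_of_irrelevant (f : (Fin n → Bool) → Bool) (K : Finset (Fin n)) :
    (∀ u, ∀ k ∈ K, ∀ b, f (Function.update u k b) = f u) →
    ∀ u v : Fin n → Bool, (∀ k, k ∉ K → u k = v k) → f u = f v := by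
  classical
  induction K using Finset.induction_on with
  | empty =>
    intro _ u v h
    rw [show u = v from funext fun k => h k (Finset.notMem_empty k)]
  | insert k0 K hk0 ih =>
    intro hirr u v huv
    rw [← hirr u k0 (mem_insert_self k0 K) (v k0)]
    refine ih (fun w k hk b => hirr w k (mem_insert_of_mem hk) b) _ v fun k hk => ?_
    by_cases hkk0 : k = k0
    · rw [hkk0, Function.update_self]
    · rw [Function.update_of_ne hkk0]
      exact huv k fun h => (mem_insert.1 h).elim hkk0 hk

/-- **Exchangeable blocks ⇒ the symmetry hypothesis of `jBlock_frob`.** -/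
theorem blockSymm_of_swap {m : ℕ} (A : Fin m → Finset (Fin n)) (hdis : ∀ j k, j ≠ k → Disjoint (A j) (A k))
    (J : Finset (Fin n)) (f : (Fin n → Bool) → Bool)
    (hswap : ∀ u (j : Fin m), ∀ i ∈ A j, ∀ i' ∈ A j, f (u ∘ Equiv.swap i i') = f u)
    (hirr : ∀ u k, k ∉ J → (∀ j, k ∉ A j) → ∀ b : Bool, f (Function.update u k b) = f u) :
    ∀ u v : Fin n → Bool, (∀ i ∈ J, u i = v i) → (∀ j, bw (A j) u = bw (A j) v) → f u = f v := by
  classical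
  intro u v hJ hbw
  -- step 1: move the irrelevant coordinates of `u` to their `v`-values
  let u₁ : Fin n → Bool := fun k => if k ∈ J ∨ ∃ j, k ∈ A j then u k else v k
  have hu₁ : f u = f u₁ := by
    refine agree_of_irrelevant f (Finset.univ.filter fun k => k ∉ J ∧ ∀ j, k ∉ A j) ?_ u u₁ ?_
    · intro w k hk b
      rw [mem_filter] at hk
      exact hirr w k hk.2.1 hk.2.2 b
    · intro k hk
      have hk' : k ∈ J ∨ ∃ j, k ∈ A j := by
        by_contra hcon
        refine hk (mem_filter.2 ⟨mem_univ k, fun h => hcon (Or.inl h), fun j h => hcon (Or.inr ⟨j, h⟩)⟩)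
      show u k = if k ∈ J ∨ ∃ j, k ∈ A j then u k else v k
      rw [if_pos hk']
  -- step 2: block by block, replace `u` by `v` using transposition invariance
  let mix : Finset (Fin m) → (Fin n → Bool) := fun S k => if ∃ j ∈ S, k ∈ A j then v k else u₁ k
  have hmix : ∀ S : Finset (Fin m), f u₁ = f (mix S) := by
    intro S
    induction S using Finset.induction_on with
    | empty =>
      congr 1
      funext k
      show u₁ k = if ∃ j ∈ (∅ : Finset (Fin m)), k ∈ A j then v k else u₁ k
      rw [if_neg (fun ⟨j, hj, _⟩ => Finset.notMem_empty j hj)]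
    | insert j0 S hj0 ih =>
      rw [ih]
      have hiff : ∀ k, k ∉ A j0 → ((∃ j ∈ S, k ∈ A j) ↔ ∃ j ∈ insert j0 S, k ∈ A j) := by
        intro k hk
        constructor
        · rintro ⟨j, hj, hk'⟩; exact ⟨j, mem_insert_of_mem hj, hk'⟩
        · rintro ⟨j, hj, hk'⟩
          rcases mem_insert.1 hj with rfl | hj'
          · exact absurd hk' hk
          · exact ⟨j, hj', hk'⟩
      refine symm_of_swap_invariant (A := A j0) f (fun w i hi i' hi' => hswap w j0 i hi i' hi')
        (mix S) (mix (insert j0 S)) (fun k hk => ?_) ?_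
      · show (if ∃ j ∈ S, k ∈ A j then v k else u₁ k) = if ∃ j ∈ insert j0 S, k ∈ A j then v k else u₁ k
        by_cases h1 : ∃ j ∈ S, k ∈ A j
        · rw [if_pos h1, if_pos ((hiff k hk).1 h1)]
        · rw [if_neg h1, if_neg (fun h2 => h1 ((hiff k hk).2 h2))]
      · have e1 : bw (A j0) (mix S) = bw (A j0) u := by
          refine bw_congr fun k hk => ?_
          have hno : ¬ ∃ j ∈ S, k ∈ A j := by
            rintro ⟨j, hj, hk'⟩
            have hne : j ≠ j0 := fun h => hj0 (by rw [← h]; exact hj)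
            exact disjoint_left.1 (hdis j j0 hne) hk' hk
          show (if ∃ j ∈ S, k ∈ A j then v k else u₁ k) = u k
          rw [if_neg hno]
          show (if k ∈ J ∨ ∃ j, k ∈ A j then u k else v k) = u k
          rw [if_pos (Or.inr ⟨j0, hk⟩)]
        have e2 : bw (A j0) (mix (insert j0 S)) = bw (A j0) v := by
          refine bw_congr fun k hk => ?_
          show (if ∃ j ∈ insert j0 S, k ∈ A j then v k else u₁ k) = v k
          rw [if_pos ⟨j0, mem_insert_self j0 S, hk⟩]
        rw [e1, e2, hbw j0]
  rw [hu₁, hmix Finset.univ]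
  congr 1
  funext k
  show (if ∃ j ∈ (Finset.univ : Finset (Fin m)), k ∈ A j then v k else u₁ k) = v k
  by_cases h : ∃ j, k ∈ A j
  · obtain ⟨j, hj⟩ := h
    rw [if_pos ⟨j, mem_univ j, hj⟩]
  · rw [if_neg (fun ⟨j, _, hj⟩ => h ⟨j, hj⟩)]
    show (if k ∈ J ∨ ∃ j, k ∈ A j then u k else v k) = v k
    by_cases hkJ : k ∈ J
    · rw [if_pos (Or.inl hkJ)]; exact hJ k hkJ
    · rw [if_neg (fun h' => h'.elim hkJ h)]

/-- **L2G-shape ⇒ law-shape** (one kernel implication).  Pairwise disjoint blocks of exchangeable variables, each of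
size `≥ p − 1` and disjoint from the junta `J`, all remaining variables irrelevant, and `deg_p f ≤ p − 1` give the
node's `FrobStructureLaw` conclusion `f u = h(u_J, Σ cᵢ uᵢ)` (via `jBlock_frob_law`). -/
theorem law_of_exchangeable_blocks (p : ℕ) [Fact p.Prime] {m : ℕ} (A : Fin m → Finset (Fin n))
    (hdis : ∀ j k, j ≠ k → Disjoint (A j) (A k)) (hA : ∀ j, p - 1 ≤ (A j).card)
    (J : Finset (Fin n)) (hJ : ∀ j, Disjoint J (A j)) (f : (Fin n → Bool) → Bool)
    (hswap : ∀ u (j : Fin m), ∀ i ∈ A j, ∀ i' ∈ A j, f (u ∘ Equiv.swap i i') = f u)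
    (hirr : ∀ u k, k ∉ J → (∀ j, k ∉ A j) → ∀ b : Bool, f (Function.update u k b) = f u)
    (hf : HasDegF p f (p - 1)) :
    ∃ (c : Fin n → ZMod p) (h : (Fin n → Bool) → ZMod p → Bool), ∀ u,
      f u = h (JLin.proj J u) (∑ i, if u i then c i else 0) :=
  jBlock_frob_law p A hdis hA J hJ f (blockSymm_of_swap A hdis J f hswap hirr) hf

end SubChar

end Summit.QuantumAdvantage.AdviceFreeQNC0
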